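import Summits.QuantumFields.YangMills.Theorems.UnitScaleTiltFluctuationComparisonRegPrGlobalSlackKernelLegDisplayTwoRunProfileV4
import HarnessLib

/-!
# `UnitScaleTiltFluctuationComparisonRegPrGlobalSlackHigherProfileV4Rec` — THE HIGHER-PROFILE DOOR OF THE DECIDING CRUX WITH 2′χ(v4) AND THE SLACK ROW MERGED AT THE RECORD'S OWN
# CONSTANTS (F-g4-1-clean form; crux `FluctuationComparisonRegPrIntL`, stmt-QuantumFields-20520, skeleton v5kD; LEAD ym-ust-20520-w2 g5, (B12); count-neutral helper, def-free,
# registry / skeleton text untouched — the registered stubs are NOT restated or closed)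

WHY.  ✓`regPrIntL_of_recChiV4_slackOnChi_higherProfile_allL` (r1 g5 / ★w2 g4's v4 twin) asks 2′χ(v4) (`AlphaInputsT3ACv4RecChi L`: for every `(b₀,p₀)` beyond thresholds SOME
constants record `𝔠` with an admissible χ-package at every cut-off) AND the slack display for EVERY constants record `𝔠`.  Its proof reads the display ONLY at the record's own `𝔠`
(`obtain ⟨𝔠, …⟩ := hrec …; … := hIμ 𝔠 …`).  For the supplier the difference matters: the cross-cut-off rows behind the display ((K₀), (Fine_b) of the natural-object doors) hold
for ONE canonical coherent family at ITS constants — F-g4-1 (`TARGET.md` (F); barrier `UVStabilityNonUniqueness`): per-`K` admissibility at some other `𝔠` never yields cross-`K`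
coherence.  THIS FILE re-threads the two doors with the hypotheses MERGED (proofs verbatim otherwise):

* **`dataOnPrintChiAt_of_recChiV4WithSlackOnChi_higherProfile`** (per `L`), ★ **`regPrIntL_of_recChiV4WithSlackOnChi_higherProfile_allL`** (STUB 1's text, T8's text, and per odd
  `L > 1` and margin `μ`: ONE `∃ b₁ p₁' ∀ b₀ p₀ ∃ 𝔠 a₀ a₁, record ∧ slack-display-at-𝔠` hypothesis);
* ★★ **`regPrIntL_of_halving_exist_recChiV4WithDisplayTwoRun_allL`**: the same from 19200's two leaves (H, EX verbatim) with the TWO-RUN display `K1aLegRowsDisplayTwoRunChiAtV4 L 𝔠 a₀ a₁ a p₁`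
  (`p₁ ≥ p₀ + r₀`) at the record's own `𝔠` (✓`globalSupRateTSlack_of_k1aLegRowsDisplayTwoRunChiAtV4` + `GlobalSlackOn.on_of_global`).

HONEST SCOPE.  Bookkeeping over hypothesis schemas; nothing of [Balaban1985UV3] / [King1986] / [Balaban1985Variational] asserted; no stub / crux / registry object touched
(`--supports stmt-QuantumFields-20520`); no summit / rung / gap claim (YM₃ on T³ is ladder rung R3, not the Clay problem).  L-floor: none (every odd `L > 1`).

References: C. King, CMP 102 (1986) 649–677 [King1986] (Thm 3.4 (3.9) p.656, (3.42) p.660); T. Bałaban, CMP 102 (1985) 255–275 [Balaban1985UV3] ((7) p.257, (28) p.263, (41) p.266,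
(47) p.267, (57) p.270, Thm 2 p.272); CMP 102 (1985) 277–309 [Balaban1985Variational] (Thm 1 (8) p.279, Prop. 7 p.299, Prop. 8 p.304); CMP 109 (1987) 249–301 [Balaban1987RG1] ((0.4) p.253).
-/

set_option autoImplicit false

noncomputable section

open MeasureTheory Filter
open Literature.MathematicalPhysics.QuantumFieldTheory.Balaban1983to89
open Literature.MathematicalPhysics.QuantumFieldTheory.Balaban1983to89.T3ContinuumYM3Torus
open Literature.MathematicalPhysics.QuantumFieldTheory.Balaban1983to89.T3LevelShift
open Literature.MathematicalPhysics.QuantumFieldTheory.Balaban1983to89.T3UnitScaleTilt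
open Literature.MathematicalPhysics.QuantumFieldTheory.Balaban1983to89.T3AlphaInputsAC
open Literature.MathematicalPhysics.QuantumFieldTheory.Balaban1983to89.T3AlphaPolymerSocket
open Literature.MathematicalPhysics.QuantumFieldTheory.Balaban1983to89.T3AlphaInputsACTwoRunLevel
open Summit.QuantumFields.YangMills.Theorems.GlobalSlack
open Summit.QuantumFields.YangMills.Theorems.PrintChi (PintCauchyOn ChiGood)

namespace Summit.QuantumFields.YangMills.Theorems.InteriorExcision

open Literature.MathematicalPhysics.QuantumFieldTheory.Balaban1983to89.T3UnitLawDensityEML (ℰp)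
open Literature.MathematicalPhysics.QuantumFieldTheory.Balaban1983to89.T3TiltDescent
open Literature.MathematicalPhysics.QuantumFieldTheory.Balaban1983to89.T3RegularMinimiser
open Literature.MathematicalPhysics.QuantumFieldTheory.Balaban1983to89.T3PrintedRegularMinimiser
open Literature.MathematicalPhysics.QuantumFieldTheory.Balaban1983to89.T3PrintedMinimiserExistence
open Literature.MathematicalPhysics.QuantumFieldTheory.Balaban1983to89.T3SmallLiftHistory
open Literature.MathematicalPhysics.QuantumFieldTheory.Balaban1983to89.T3LogComparisonSocket
open Literature.MathematicalPhysics.QuantumFieldTheory.Balaban1983to89.T3LowerAlongMinimisersSplit (MinimisersIn8At)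
open Literature.MathematicalPhysics.QuantumFieldTheory.Balaban1983to89.T3InteriorExcision
open Summit.QuantumFields.YangMills.Theorems.PrintChi
open Summit.QuantumFields.YangMills.Theorems.GlobalSlackOn (levelCauchyOnOfGlobalSupRateTSlackOn_higherProfile_dec)
open Summit.QuantumFields.YangMills.Theorems.LogComparisonRepAtHeightsOn (atHeights printChiSets)

/-! ## §1 The per-`L` data from one record-with-slack hypothesis -/

/-- **THE LOWER/(A)/CAUCHY DATA ON PRINT'S χ FROM ONE RECORD-WITH-SLACK HYPOTHESIS** (F-g4-1-clean form of ✓`dataOnPrintChiAt_of_laneRecordsV4Chi_slackOnChi_higherProfile`): the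
2′χ(v4) record `AlphaInputsT3ACv4RecChi L` and the registered-currency slack row are asked TOGETHER — for every `(b₀, p₀)` beyond thresholds, constants `𝔠` with `𝔠.b₀ = b₀`,
`𝔠.p₀ = p₀`, [7]-constants, the χ-package existence `OfV4ChiAt` AND, AT THAT SAME `𝔠`, a rate, a profile `p₁ ≥ 𝔠.p₀`, a threshold and coherent packages with
`GlobalSupRateTSlackOn (dataOfV4chi p π) (ChiGood … μ_L) 𝔠.b₀ p₁ a σ C` — instead of the record for SOME `𝔠` and the display for EVERY `𝔠`.  The original proof reads the display
only at the record's `𝔠`; this is that proof with the two hypotheses merged (verbatim otherwise).  Why: a supplier with ONE canonical cross-cut-off-coherent family proves its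
two-run rows at ITS OWN constants, not at every constants record admitting some admissible package (F-g4-1: per-`K` admissibility never yields cross-`K` coherence).
[cite: King1986, Thm 3.4 (3.9) p.656, (3.42) p.660; Balaban1985UV3, (7) p.257, (28) p.263, (41) p.266, (47) p.267, (57) p.270, Thm 2 p.272; Balaban1985Variational, Thm 1 (8) p.279] -/
theorem dataOnPrintChiAt_of_recChiV4WithSlackOnChi_higherProfile (L : ℕ) (hLo : Odd L) (hL : 1 < L)
    (h2I : ∃ (b₁ p₁' : ℝ), ∀ (b₀ p₀ : ℝ), b₁ ≤ b₀ → p₁' ≤ p₀ →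
      ∃ (𝔠 : Summit.QuantumFields.Balaban3D.Proofs.Primitives.AlphaConsts L (Summit.QuantumFields.Balaban3D.Carriers.suGroupModel 2).N) (a₀ a₁ : ℝ),
        𝔠.b₀ = b₀ ∧ 𝔠.p₀ = p₀ ∧ 0 < a₀ ∧ 0 < a₁ ∧ 𝔠.B₃ * a₁ ≤ a₀ ∧
        (∀ (F : T3Family) (hF : F.L = L), Summit.QuantumFields.YangMills.Theorems.AlphaInputsT3AC.OfV4ChiAt F (hF ▸ 𝔠) a₀ a₁) ∧
        ∃ a : ℝ, 0 < a ∧ ∃ p₁ : ℝ, 𝔠.p₀ ≤ p₁ ∧ ∃ γB : ℝ, 0 < γB ∧ ∀ (F : T3Family) (γ : ℝ) (hF : F.L = L) (hγ : 0 < γ), γ ≤ γB →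
          ∀ (hγ1 : γ ≤ (min (hF ▸ 𝔠).gamma0 1) ^ 2),
            Summit.QuantumFields.YangMills.Theorems.AlphaInputsT3AC.OfV4ChiAt F (hF ▸ 𝔠) a₀ a₁ →
            ∃ (p : ∀ K, Summit.QuantumFields.YangMills.Theorems.AlphaInputsT3AC.PkgAtV4Chi F (hF ▸ 𝔠) γ hγ hγ1 K),
              (∀ K, (p K).a₀ = a₀ ∧ (p K).a₁ = a₁) ∧
              ∃ (π : Summit.QuantumFields.YangMills.Theorems.AlphaInputsT3AC.PolymerT3 F) (σ : ℕ) (C : ℝ), 7 ≤ σ ∧ 0 ≤ C ∧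
                ∀ ε₀ : ℝ, 0 < ε₀ → ε₀ ≤ a₀ →
                  Summit.QuantumFields.YangMills.Theorems.GlobalSlackOn.GlobalSupRateTSlackOn
                    (Summit.QuantumFields.YangMills.Theorems.AlphaInputsT3AC.dataOfV4chi p π)
                    (fun K n h V => ChiGood F γ (hF ▸ 𝔠).b₀ (hF ▸ 𝔠).p₀ ε₀ (1 - 2 / ((L : ℝ) * Real.sqrt L)) (n := n) (K := K) h V)
                    (hF ▸ 𝔠).b₀ p₁ a σ C) :
    ∃ (b₁ p₁ : ℝ), ∀ (b₀ p₀ : ℝ), b₁ ≤ b₀ → p₁ ≤ p₀ → 0 < b₀ → 2 < p₀ →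
      ∃ ε₁ : ℝ, 0 < ε₁ ∧ ∀ (ε₀ : ℝ), 0 < ε₀ → ε₀ ≤ ε₁ → ∃ m₀ : ℕ, ∀ (m : ℕ), m₀ ≤ m →
        ∃ γ₁ : ℝ, 0 < γ₁ ∧ ∀ (F : T3Family) (γ : ℝ), F.L = L → 0 < γ → γ ≤ γ₁ →
          ∃ D : AlphaDataT3 F γ,
            (∀ (K n : ℕ) (hnK : n < K) (V : GaugeField (F.P n) 0 (Matrix.specialUnitaryGroup (Fin 2) ℂ)),
              PlaqSmall (θBal F.L γ b₀ p₀ n) V →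
                D.Umin K (K - n) (D.triv K (K - n))
                    (fieldShift (F.sitesPerDir_eq (m := F.m) (K := K) (j := K - n) (m' := F.m) (K' := n) (j' := 0) (by omega)) V) ∈
                  regFibrePr F n K hnK.le ε₀ V ∧
                wilsonAction4 (D.Umin K (K - n) (D.triv K (K - n))
                    (fieldShift (F.sitesPerDir_eq (m := F.m) (K := K) (j := K - n) (m' := F.m) (K' := n) (j' := 0) (by omega)) V)) =
                  minActionRegPr F n K hnK.le ε₀ V) ∧
            TwoSidedRepOn F γ b₀ p₀ (atHeights (printChiSets D b₀ p₀)) ε₀ D.PintH D.EcstH D.RmH ∧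
            PintCauchyOn F γ b₀ p₀
              (fun K n h V => ChiGood F γ b₀ p₀ ε₀ (1 - 2 / ((F.L : ℝ) * Real.sqrt F.L)) (n := n) (K := K) h V) m D.PintH := by
  obtain ⟨b₁, p₁, hrec⟩ := h2I
  refine ⟨b₁, p₁, fun b₀ p₀ hb1 hp1 hb hp => ?_⟩
  obtain ⟨𝔠, a₀, a₁, hcb, hcp, ha0, ha1, hw, h𝔠, a, ha, q₁, hq₁, γB, hγB, hBC⟩ := hrec b₀ p₀ hb1 hp1
  subst hcb
  subst hcp
  obtain ⟨εs, hεs, hS⟩ := levelCauchyOnOfGlobalSupRateTSlackOn_higherProfile_dec L hLo hL a ha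
  refine ⟨min a₀ εs, lt_min ha0 hεs, fun ε₀ h0 h1 => ?_⟩
  have h1a : ε₀ ≤ a₀ := h1.trans (min_le_left _ _)
  have h1s : ε₀ ≤ εs := h1.trans (min_le_right _ _)
  obtain ⟨m₀, hm₀⟩ := hS ε₀ h0 h1s
  refine ⟨m₀, fun m hm => ?_⟩
  obtain ⟨γT, hγT, -, hT⟩ := Summit.QuantumFields.YangMills.Theorems.LogComparisonAlphaAdapter.exists_gamma_thresholds
    (B₃ := 𝔠.B₃) 𝔠.b₀_pos 𝔠.p₀_pos ha1 𝔠.B₃_pos.le h0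
  have hg0 : 0 < (min 𝔠.gamma0 1) ^ 2 := pow_pos (lt_min 𝔠.gamma0_pos one_pos) 2
  obtain ⟨γs, hγs, hS'⟩ := hm₀ m hm 𝔠.b₀ 𝔠.p₀ hb hp
  refine ⟨min (min γB (min γT ((min 𝔠.gamma0 1) ^ 2))) γs,
    lt_min (lt_min hγB (lt_min hγT hg0)) hγs, fun F γ hF hγ hγ₁ => ?_⟩
  subst hF
  have hγB' : γ ≤ γB := hγ₁.trans ((min_le_left _ _).trans (min_le_left _ _))
  have hγT' : γ ≤ γT := hγ₁.trans ((min_le_left _ _).trans ((min_le_right _ _).trans (min_le_left _ _)))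
  have hγ1 : γ ≤ (min 𝔠.gamma0 1) ^ 2 := hγ₁.trans ((min_le_left _ _).trans ((min_le_right _ _).trans (min_le_right _ _)))
  have hγs' : γ ≤ γs := hγ₁.trans (min_le_right _ _)
  obtain ⟨p, hp', π, σ, C, hσ, hC0, hG⟩ := hBC F γ rfl hγ hγB' hγ1 (h𝔠 F rfl)
  obtain ⟨hT1, hT2, hT3⟩ := hT F.L F.hL.2.le γ hγ hγT'
  refine ⟨Summit.QuantumFields.YangMills.Theorems.AlphaInputsT3AC.dataOfV4chi p π, fun K n hnK V hV => ?_, ?_, ?_⟩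
  · exact Summit.QuantumFields.YangMills.Theorems.AlphaInputsT3AC.dataOfV4chi_uminTriv p π K n hnK ε₀
      (by rw [(hp' K).2]; exact hT1 n) (hT2 n) (by rw [(hp' K).1]; exact h1a) V hV
  · exact Summit.QuantumFields.YangMills.Theorems.AlphaInputsT3AC.twoSidedRepOnPrintChi_dataOfV4chi p π hp' ε₀ h0 h1a hT1 hT2 hT3
  · exact hS' F γ rfl hγ hγs' _ (Summit.QuantumFields.YangMills.Theorems.AlphaInputsT3AC.dataOfV4chi p π) q₁ σ C hq₁ hσ hC0 (hG ε₀ h0 h1a)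

/-! ## §2 The crux from STUB 1, T8 and one record-with-slack hypothesis -/

/-- **THE DECIDING CRUX FROM STUB 1, T8 AND ONE RECORD-WITH-SLACK HYPOTHESIS PER ODD BLOCK SIZE AND MARGIN** (F-g4-1-clean form of
✓`regPrIntL_of_recChiV4_slackOnChi_higherProfile_allL`: 2′χ(v4) and the slack-on-χ row at a higher profile merged at the record's own `𝔠`).
[cite: King1986, Thm 3.4 (3.9) p.656, (3.42) p.660; Balaban1985UV3, (28) p.263, (41) p.266, (47) p.267, (57) p.270, Thm 2 p.272; Balaban1985Variational, Thm 1 (8) p.279; Balaban1987RG1, (0.4) p.253] -/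
theorem regPrIntL_of_recChiV4WithSlackOnChi_higherProfile_allL
    (h1 : ∀ L : ℕ, ∃ κ δ₀ : ℝ, κ * Real.sqrt L ≤ 1 ∧ 0 < δ₀ ∧ ∀ F : T3Family, F.L = L → OneStepSmallLift F ℰp κ δ₀)
    (hT8 : ∀ L : ℕ, Odd L → 1 < L → ∃ a₀ a₁ B₃ : ℝ, 0 < a₀ ∧ 0 < a₁ ∧ 0 < B₃ ∧
      Thm1GlobalMinAt L a₀ a₁ B₃ ∧ MinimisersIn8At L a₀ a₁ B₃)
    (h2I : ∀ (L : ℕ), Odd L → 1 < L → ∀ (μ : ℝ), 0 < μ → μ < 1 →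
      ∃ (b₁ p₁' : ℝ), ∀ (b₀ p₀ : ℝ), b₁ ≤ b₀ → p₁' ≤ p₀ →
        ∃ (𝔠 : Summit.QuantumFields.Balaban3D.Proofs.Primitives.AlphaConsts L (Summit.QuantumFields.Balaban3D.Carriers.suGroupModel 2).N) (a₀ a₁ : ℝ),
          𝔠.b₀ = b₀ ∧ 𝔠.p₀ = p₀ ∧ 0 < a₀ ∧ 0 < a₁ ∧ 𝔠.B₃ * a₁ ≤ a₀ ∧
          (∀ (F : T3Family) (hF : F.L = L), Summit.QuantumFields.YangMills.Theorems.AlphaInputsT3AC.OfV4ChiAt F (hF ▸ 𝔠) a₀ a₁) ∧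
          ∃ a : ℝ, 0 < a ∧ a < 1 ∧ ∃ p₁ : ℝ, 𝔠.p₀ ≤ p₁ ∧ ∃ γB : ℝ, 0 < γB ∧ ∀ (F : T3Family) (γ : ℝ) (hF : F.L = L) (hγ : 0 < γ), γ ≤ γB →
          ∀ (hγ1 : γ ≤ (min (hF ▸ 𝔠).gamma0 1) ^ 2),
            Summit.QuantumFields.YangMills.Theorems.AlphaInputsT3AC.OfV4ChiAt F (hF ▸ 𝔠) a₀ a₁ →
            ∃ (p : ∀ K, Summit.QuantumFields.YangMills.Theorems.AlphaInputsT3AC.PkgAtV4Chi F (hF ▸ 𝔠) γ hγ hγ1 K),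
              (∀ K, (p K).a₀ = a₀ ∧ (p K).a₁ = a₁) ∧
              ∃ (π : Summit.QuantumFields.YangMills.Theorems.AlphaInputsT3AC.PolymerT3 F) (σ : ℕ) (C : ℝ), 7 ≤ σ ∧ 0 ≤ C ∧
                ∀ ε₀ : ℝ, 0 < ε₀ → ε₀ ≤ a₀ →
                  Summit.QuantumFields.YangMills.Theorems.GlobalSlackOn.GlobalSupRateTSlackOn
                    (Summit.QuantumFields.YangMills.Theorems.AlphaInputsT3AC.dataOfV4chi p π)
                    (fun K n h V => ChiGood F γ (hF ▸ 𝔠).b₀ (hF ▸ 𝔠).p₀ ε₀ μ (n := n) (K := K) h V)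
                    (hF ▸ 𝔠).b₀ p₁ a σ C) :
    FluctuationComparisonRegPrIntL :=
  regPrIntL_of_dataOnPrintChi hT8
    (fun L hLo hL => by
      have hμ := muL_pos_lt_one hL
      obtain ⟨b₁, p₁', hrec⟩ := h2I L hLo hL _ hμ.1 hμ.2
      exact dataOnPrintChiAt_of_recChiV4WithSlackOnChi_higherProfile L hLo hL ⟨b₁, p₁', fun b₀ p₀ hb1 hp1 => by
        obtain ⟨𝔠, a₀, a₁, hcb, hcp, ha0, ha1, hw, h𝔠, a, ha, -, p₁, hp₁, γB, hγB, hall⟩ := hrec b₀ p₀ hb1 hp1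
        exact ⟨𝔠, a₀, a₁, hcb, hcp, ha0, ha1, hw, h𝔠, a, ha, p₁, hp₁, γB, hγB, hall⟩⟩)
    (Summit.QuantumFields.YangMills.Theorems.OneStepSubmersion.posOnSmall_of_oneStepSmallLift h1)

/-! ## §3 The same from 19200's two leaves with the two-run display at the record's own constants -/

open Literature.MathematicalPhysics.QuantumFieldTheory.Balaban1983to89.T3ConstrainedMinimiser (fibre)
open Literature.MathematicalPhysics.QuantumFieldTheory.Balaban1983to89.T3Thm1Carrier (famX Idx)
open Summit.QuantumFields.YangMills.Theorems.GlobalSlackKernelLeg (K1aLegRowsDisplayTwoRunChiAtV4 globalSupRateTSlack_of_k1aLegRowsDisplayTwoRunChiAtV4)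

/-- ★★ **THE DECIDING CRUX FROM 19200's TWO LEAVES AND ONE RECORD-WITH-TWO-RUN-DISPLAY HYPOTHESIS PER ODD BLOCK SIZE**: the texts of `stub_halvingStep` (H) and
`stub_existenceMinimalOrbit` (EX) VERBATIM, and for every odd `L > 1`: `∃ b₁ p₁', ∀ b₀ p₀` beyond, `∃ 𝔠 a₀ a₁` with `𝔠.b₀ = b₀`, `𝔠.p₀ = p₀`, [7]-constants, `OfV4ChiAt` at every family,
AND a rate `a ∈ (0,1)`, a profile `p₁ ≥ p₀ + r₀` with `K1aLegRowsDisplayTwoRunChiAtV4 L 𝔠 a₀ a₁ a p₁` AT THAT `𝔠` ⟹ `FluctuationComparisonRegPrIntL` — T8 by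
`AttainmentOfExistence.thm1In8GlobalMin_of_halvingStep_of_existence`, STUB 1 by `ApproxLift.AnsatzT.stub_oneStepSmallLift`, the display → slack-on-χ at `p₁` by
✓`globalSupRateTSlack_of_k1aLegRowsDisplayTwoRunChiAtV4` + `GlobalSlackOn.on_of_global`, then §2.  This is the consumer the natural-object doors (✓`…TwoRunDoorPrint` etc.) are meant for.
[cite: Balaban1985Variational, Thm 1 (8) p.279, Prop. 7 p.299, Prop. 8 p.304; Balaban1985UV3, (41) p.266, (43)-(47) pp.266-267, (57) p.270, Thm 2 p.272; King1986, Thm 3.4 (3.9) p.656, Prop. 3.6 (3.56) p.662] -/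
theorem regPrIntL_of_halving_exist_recChiV4WithDisplayTwoRun_allL
    (hV2 : ∀ (L : ℕ), 1 < L → ∃ B₃ : ℝ, 4 < B₃ ∧ ∃ a₅ : ℝ, 0 < a₅ ∧
      ∀ (i : Idx L) (ε₀ ε₁ : ℝ), 0 < ε₁ → ∀ (V : (famX L i).Bdry) (U : (famX L i).Cfg), (famX L i).Reg7 ε₁ V → (famX L i).InU ε₀ U →
        (famX L i).InB V U → (famX L i).IsCritical V U → ε₀ ≤ a₅ → (famX L i).InU (max (B₃ * ε₁) (ε₀ / 2)) U)
    (hEX : ∀ (L : ℕ), 1 < L → ∀ (B₃ : ℝ), 4 < B₃ → ∃ a₁' O₁ : ℝ, 0 < a₁' ∧ 1 ≤ O₁ ∧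
      ∀ (F : T3Family), F.L = L → ∀ (n K : ℕ) (hnK : n < K) (ε₁ : ℝ), 0 < ε₁ →
        ∀ V : GaugeField (F.P n) 0 (Matrix.specialUnitaryGroup (Fin 2) ℂ), PlaqSmall ε₁ V →
          ∀ U₀ : GaugeField (F.P K) 0 (Matrix.specialUnitaryGroup (Fin 2) ℂ), RegPr F n K ((L : ℝ) ^ 3 * B₃ * ε₁) U₀ → U₀ ∈ fibre F ℰp n K hnK.le V →
            ε₁ ≤ a₁' → ∃ U ∈ regFibrePr F n K hnK.le (O₁ * (L : ℝ) ^ 3 * B₃ * ε₁) V,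
              IsMinOn (fun W : GaugeField (F.P K) 0 (Matrix.specialUnitaryGroup (Fin 2) ℂ) => wilsonAction4 W)
                (regFibrePr F n K hnK.le (O₁ * (L : ℝ) ^ 3 * B₃ * ε₁) V) U)
    (h2D : ∀ (L : ℕ), Odd L → 1 < L →
      ∃ (b₁ p₁' : ℝ), ∀ (b₀ p₀ : ℝ), b₁ ≤ b₀ → p₁' ≤ p₀ →
        ∃ (𝔠 : Summit.QuantumFields.Balaban3D.Proofs.Primitives.AlphaConsts L (Summit.QuantumFields.Balaban3D.Carriers.suGroupModel 2).N) (a₀ a₁ : ℝ),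
          𝔠.b₀ = b₀ ∧ 𝔠.p₀ = p₀ ∧ 0 < a₀ ∧ 0 < a₁ ∧ 𝔠.B₃ * a₁ ≤ a₀ ∧
          (∀ (F : T3Family) (hF : F.L = L), Summit.QuantumFields.YangMills.Theorems.AlphaInputsT3AC.OfV4ChiAt F (hF ▸ 𝔠) a₀ a₁) ∧
          ∃ a : ℝ, 0 < a ∧ a < 1 ∧ ∃ p₁ : ℝ, 𝔠.p₀ + 𝔠.r₀ ≤ p₁ ∧ K1aLegRowsDisplayTwoRunChiAtV4 L 𝔠 a₀ a₁ a p₁) :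
    FluctuationComparisonRegPrIntL := by
  refine regPrIntL_of_recChiV4WithSlackOnChi_higherProfile_allL Summit.QuantumFields.YangMills.Theorems.ApproxLift.AnsatzT.stub_oneStepSmallLift
    (AttainmentOfExistence.thm1In8GlobalMin_of_halvingStep_of_existence hV2 hEX) fun L hLo hL μ _ _ => ?_
  obtain ⟨b₁, p₁', hrec⟩ := h2D L hLo hL
  refine ⟨b₁, p₁', fun b₀ p₀ hb1 hp1 => ?_⟩
  obtain ⟨𝔠, a₀, a₁, hcb, hcp, ha0, ha1, hw, h𝔠, a, ha, ha1', p₁, hp₁, hD⟩ := hrec b₀ p₀ hb1 hp1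
  obtain ⟨γB, hγB, hall⟩ := globalSupRateTSlack_of_k1aLegRowsDisplayTwoRunChiAtV4 ha ha1' hp₁ hD
  have hp₀p₁ : 𝔠.p₀ ≤ p₁ := le_trans (le_add_of_nonneg_right (le_trans zero_le_one 𝔠.one_le_r₀)) hp₁
  refine ⟨𝔠, a₀, a₁, hcb, hcp, ha0, ha1, hw, h𝔠, a, ha, ha1', p₁, hp₀p₁, γB, hγB, fun F γ hF hγ hγle hγ1 hOf => ?_⟩
  obtain ⟨p, hp, π, σ, C, hσ, hC, hG⟩ := hall F γ hF hγ hγle hγ1 hOf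
  exact ⟨p, hp, π, σ, C, hσ, hC, fun ε₀ _ _ => GlobalSlackOn.on_of_global _ _ hG⟩

end Summit.QuantumFields.YangMills.Theorems.InteriorExcision

end
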